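import Literature.Analysis.UnboundedOperators.HilleYosidaSemigroup
import Literature.Analysis.UnboundedOperators.SemigroupLaplaceResolventGenerator
import Literature.Analysis.UnboundedOperators.StrongContRepresentationDensityProofs
import Mathlib.MeasureTheory.Integral.DominatedConvergence
import HarnessLib

/-!
# The Hille–Yosida generation theorem (contraction case), part 3: the Laplace transform of the
  Hille–Yosida semigroup is `J`, its generator is `operatorOfResolvent J`

Analysis/UnboundedOperators proofs-layer file (theorems only, no definitions, no named facts),
completing Engel–Nagel (2000), Ch. II Thm. 3.5 for the semigroup `h.semigroup` of parts 1–2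
(`HilleYosidaApproximants.lean`, `HilleYosidaSemigroup.lean`). With `T = h.semigroup`,
`A = operatorOfResolvent J 1 _` (Kato VIII-§1.1: `D(A) = Ran J(1)`, `A(J(1)y) = J(1)y − y`,
and then `A(J(z)v) = zJ(z)v − v` for every `z ∈ U`) and `B = T.generator`:

* §1 `app_sub_self_eq_integral`: for `x ∈ D(A)`, **`T(t)x − x = ∫₀ᵗ T(s)(Ax) ds`** — the limit
  `λ → ∞` of `exp (tY_λ)x − x = ∫₀ᵗ exp (sY_λ) Y_λ x ds` (fundamental theorem of calculus for the
  bounded generator, dominated convergence with `Y_λ x → Ax`, `‖exp (sY_λ)‖ ≤ 1`);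
* §2 `mem_generator_domain`: hence `x ∈ D(B)` and `Bx = Ax` (`A ⊆ B`; right derivative at `0` by
  the fundamental theorem of calculus and the tree's `mem_generator_domain_of_hasDerivWithinAt`);
* §3 **`laplaceResolvent_eq`**: `∫₀^∞ e^{−λt}T(t)y dt = J(λ)y` for every `λ ∈ U` with `Re λ > 0`
  (`(λ − B)J(λ) = (λ − A)J(λ) = 1` and the tree's `R_B(λ)(λ − B) = 1_{D(B)}`,
  `SemigroupLaplaceResolventGenerator.lean`); `laplaceResolvent_eq_of_real` for real `λ > 0`;
* §4 **`generator_eq_operatorOfResolvent`**: `B = A` as partially defined operators; and the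
  headline **`exists_c0Semigroup`**: Hille–Yosida data generate a contraction C₀-semigroup whose
  Laplace transform is `J` and whose generator is `operatorOfResolvent J`.

This is the generation theorem in the form the tree's closed operators come in (selfsim's
`generatorOdd`/`resolventOdd` for the sheet linearisation, the Jia–Šverák/ABC similarity-variable
operators through their pseudo-resolvents): a resolvent bound `‖J(λ)‖ ≤ 1/λ` plus a dense domain
IS a strongly continuous contraction evolution. WHAT IS NOT HERE: the general (`M`, `ω`)
Hille–Yosida theorem (all powers `‖(λ − ω)ⁿJ(λ)ⁿ‖ ≤ M`; the case `M = 1` follows from this file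
by the shift `J(· + ω)`), Lumer–Phillips in dissipativity language, uniqueness of the semigroup
with a given generator.

## References

* K.-J. Engel, R. Nagel, *One-Parameter Semigroups for Linear Evolution Equations* (2000),
  Ch. II Thm. 3.5 (Generation Theorem, contraction case) and its proof; Ch. II Thm. 1.10.
  [EngelNagel2000]
* T. Kato, *Perturbation Theory for Linear Operators* (1966), IX-§1.2, VIII-§1.1. [Kato1966]
* A. Pazy, *Semigroups of Linear Operators and Applications to PDE* (1983), Thm. 1.3.1.
-/

noncomputable section

open NormedSpace Filter Set Metric MeasureTheory Literature.Analysis.OperatorTheory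
open scoped Topology NNReal

namespace Literature.Analysis.UnboundedOperators

namespace HilleYosida

namespace IsHilleYosidaData

variable {E : Type*} [NormedAddCommGroup E] [NormedSpace ℂ E] [CompleteSpace E]
variable {U : Set ℂ} {J : ℂ → E →L[ℂ] E}

/-! ### §1 `T(t)x − x = ∫₀ᵗ T(s)(Ax) ds` on the domain -/

/-- Fundamental theorem of calculus for the bounded generator:
`exp (tY)x − x = ∫₀ᵗ exp (sY)(Yx) ds`. [cite: EngelNagel2000, Ch. I Prop. 3.5] -/
theorem exp_apply_sub_self_eq_integral (Y : E →L[ℂ] E) (x : E) (t : ℝ) :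
    exp ((t : ℂ) • Y) x - x = ∫ s in (0 : ℝ)..t, exp ((s : ℂ) • Y) (Y x) := by
  have hderiv : ∀ s ∈ uIcc (0 : ℝ) t,
      HasDerivAt (fun v : ℝ => exp ((v : ℂ) • Y) x) (exp ((s : ℂ) • Y) (Y x)) s := by
    intro s _
    have h := hasDerivAt_exp_ofReal_smul_apply Y x s
    rwa [mul_apply_eq_comp] at h
  have hcont : Continuous fun s : ℝ => exp ((s : ℂ) • Y) (Y x) := continuous_exp_ofReal_smul_apply Y (Y x)
  rw [intervalIntegral.integral_eq_sub_of_hasDerivAt hderiv (hcont.intervalIntegrable _ _)]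
  simp only [Complex.ofReal_zero, zero_smul, exp_zero, one_apply_eq_self]

/-- Convergence of the integrands: `exp (sY_λ)(Y_λ x) → T(s)(Ax)` for `x = J(1)y`, `Ax = x − y`,
`s ≥ 0`. [cite: EngelNagel2000, Ch. II Thm. 3.5 proof] -/
theorem tendsto_exp_yosida_apply_yosida (h : IsHilleYosidaData U J) {s : ℝ} (hs : 0 ≤ s) (y : E) :
    Tendsto (fun l : ℝ => exp ((s : ℂ) • yosida J l) (yosida J l (J 1 y))) atTop
      (𝓝 (h.semigroupFun s (J 1 y - y))) := by
  set w : E := J 1 y - y with hw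
  have h1 : Tendsto (fun l : ℝ => exp ((s : ℂ) • yosida J l) w) atTop (𝓝 (h.semigroupFun s w)) :=
    h.tendsto_semigroupFun hs w
  have h2 : Tendsto (fun l : ℝ => ‖yosida J l (J 1 y) - w‖) atTop (𝓝 0) := by
    have := (h.tendsto_yosida_apply_resolvent y).sub_const w
    rw [hw, sub_self] at this
    exact tendsto_norm_zero.comp this
  rw [tendsto_iff_norm_sub_tendsto_zero]
  have h3 : Tendsto (fun l : ℝ => ‖yosida J l (J 1 y) - w‖
      + ‖exp ((s : ℂ) • yosida J l) w - h.semigroupFun s w‖) atTop (𝓝 0) := by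
    have := h2.add (tendsto_iff_norm_sub_tendsto_zero.1 h1)
    rwa [add_zero] at this
  refine squeeze_zero' (Eventually.of_forall fun l => norm_nonneg _) ?_ h3
  filter_upwards [eventually_gt_atTop (0 : ℝ)] with l hl
  calc ‖exp ((s : ℂ) • yosida J l) (yosida J l (J 1 y)) - h.semigroupFun s w‖
      = ‖exp ((s : ℂ) • yosida J l) (yosida J l (J 1 y) - w)
          + (exp ((s : ℂ) • yosida J l) w - h.semigroupFun s w)‖ := by
        congr 1; rw [map_sub]; abel
    _ ≤ ‖exp ((s : ℂ) • yosida J l) (yosida J l (J 1 y) - w)‖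
          + ‖exp ((s : ℂ) • yosida J l) w - h.semigroupFun s w‖ := norm_add_le _ _
    _ ≤ ‖yosida J l (J 1 y) - w‖ + ‖exp ((s : ℂ) • yosida J l) w - h.semigroupFun s w‖ :=
        add_le_add (h.norm_exp_yosida_apply_le hl hs _) le_rfl

/-- **`T(t)x − x = ∫₀ᵗ T(s)(Ax) ds` for `x = J(1)y ∈ D(A)`, `Ax = x − y`** (`t ≥ 0`): dominated
convergence in `exp (tY_λ)x − x = ∫₀ᵗ exp (sY_λ)Y_λ x ds` (bound `‖x − y‖`).
[cite: EngelNagel2000, Ch. II Thm. 3.5 proof] -/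
theorem semigroupFun_sub_self_eq_integral (h : IsHilleYosidaData U J) {t : ℝ} (ht : 0 ≤ t) (y : E) :
    h.semigroupFun t (J 1 y) - J 1 y = ∫ s in (0 : ℝ)..t, h.semigroupFun s (J 1 y - y) := by
  -- left-hand sides converge
  have hL : Tendsto (fun l : ℝ => exp ((t : ℂ) • yosida J l) (J 1 y) - J 1 y) atTop
      (𝓝 (h.semigroupFun t (J 1 y) - J 1 y)) := (h.tendsto_semigroupFun ht _).sub_const _
  -- right-hand sides converge (dominated convergence on `[0, t]`)
  have hR : Tendsto (fun l : ℝ => ∫ s in (0 : ℝ)..t, exp ((s : ℂ) • yosida J l) (yosida J l (J 1 y)))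
      atTop (𝓝 (∫ s in (0 : ℝ)..t, h.semigroupFun s (J 1 y - y))) := by
    refine intervalIntegral.tendsto_integral_filter_of_dominated_convergence (fun _ => ‖J 1 y - y‖)
      ?_ ?_ ?_ ?_
    · exact Eventually.of_forall fun l =>
        (continuous_exp_ofReal_smul_apply _ _).aestronglyMeasurable
    · filter_upwards [eventually_gt_atTop (0 : ℝ)] with l hl
      refine Eventually.of_forall fun s hs => ?_
      have hs0 : 0 ≤ s := by
        rw [uIoc_of_le ht] at hs
        exact hs.1.le
      exact (h.norm_exp_yosida_apply_le hl hs0 _).trans (h.norm_yosida_apply_resolvent_le hl y)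
    · exact intervalIntegrable_const
    · refine Eventually.of_forall fun s hs => ?_
      have hs0 : 0 ≤ s := by
        rw [uIoc_of_le ht] at hs
        exact hs.1.le
      exact h.tendsto_exp_yosida_apply_yosida hs0 y
  have hEq : (fun l : ℝ => exp ((t : ℂ) • yosida J l) (J 1 y) - J 1 y) =
      fun l : ℝ => ∫ s in (0 : ℝ)..t, exp ((s : ℂ) • yosida J l) (yosida J l (J 1 y)) :=
    funext fun l => exp_apply_sub_self_eq_integral _ _ _
  rw [hEq] at hL
  exact tendsto_nhds_unique hL hR

/-- The same with the semigroup in real time: `T(t)x = x + ∫₀ᵗ T(s⁺)(x − y) ds`, `x = J(1)y`.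
[cite: EngelNagel2000, Ch. II Thm. 3.5 proof] -/
theorem semigroup_app_eq_add_integral (h : IsHilleYosidaData U J) {t : ℝ} (ht : 0 ≤ t) (y : E) :
    h.semigroup.app t.toNNReal (J 1 y) =
      J 1 y + ∫ s in (0 : ℝ)..t, h.semigroup.app s.toNNReal (J 1 y - y) := by
  rw [semigroup_app, Real.coe_toNNReal _ ht, ← sub_eq_iff_eq_add', h.semigroupFun_sub_self_eq_integral ht]
  refine intervalIntegral.integral_congr fun s hs => ?_
  have hs0 : 0 ≤ s := by
    rw [uIcc_of_le ht] at hs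
    exact hs.1
  simp only [semigroup_app, Real.coe_toNNReal _ hs0]

/-! ### §2 The generator extends `A` -/

omit [CompleteSpace E] in
/-- `1 ∈ U`. [cite: EngelNagel2000, Ch. II Thm. 3.5] -/
theorem one_mem (h : IsHilleYosidaData U J) : (1 : ℂ) ∈ U := by simpa using h.mem 1 one_pos

omit [CompleteSpace E] in
/-- `J(1)` is injective (so `operatorOfResolvent J 1` is available). [cite: Kato1966, VIII-§1.1] -/
theorem injective_one (h : IsHilleYosidaData U J) : Function.Injective (J 1) := h.injective h.one_mem

/-- **`J(1)y ∈ D(B)` and `B(J(1)y) = J(1)y − y`** for the generator `B` of the Hille–Yosida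
semigroup: the orbit `t ↦ T(t)x = x + ∫₀ᵗ T(s)(x − y) ds` has right derivative `x − y` at `0`.
[cite: EngelNagel2000, Ch. II Thm. 3.5 proof] -/
theorem mem_generator_domain_resolvent (h : IsHilleYosidaData U J) (y : E) :
    ∃ hx : J 1 y ∈ h.semigroup.generator.domain, h.semigroup.generator ⟨J 1 y, hx⟩ = J 1 y - y := by
  set T := h.semigroup with hT
  have hcont : Continuous fun s : ℝ => T.app s.toNNReal (J 1 y - y) := T.continuous_app_toNNReal _
  -- `G(t) = x + ∫₀ᵗ T(s)(x − y) ds` has derivative `T(0)(x − y) = x − y` at `0`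
  have hG : HasDerivAt (fun t : ℝ => J 1 y + ∫ s in (0 : ℝ)..t, T.app s.toNNReal (J 1 y - y))
      (T.app (0 : ℝ).toNNReal (J 1 y - y)) 0 :=
    ((hcont.integral_hasStrictDerivAt 0 0).hasDerivAt).const_add _
  rw [Real.toNNReal_zero, C0Semigroup.app_zero, one_apply_eq_self] at hG
  have hderiv : HasDerivWithinAt (fun s : ℝ => T.app s.toNNReal (J 1 y)) (J 1 y - y) (Ici 0) 0 := by
    refine hG.hasDerivWithinAt.congr (fun s (hs : 0 ≤ s) => ?_) ?_
    · exact h.semigroup_app_eq_add_integral hs y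
    · simp only [intervalIntegral.integral_same, add_zero, Real.toNNReal_zero, C0Semigroup.app_zero,
        one_apply_eq_self]
  exact T.mem_generator_domain_of_hasDerivWithinAt hderiv

/-- **The generator extends `A = operatorOfResolvent J`**: every `x ∈ D(A)` lies in `D(B)` with
`Bx = Ax`. [cite: EngelNagel2000, Ch. II Thm. 3.5 proof] -/
theorem mem_generator_domain (h : IsHilleYosidaData U J)
    (x : (operatorOfResolvent J 1 h.injective_one).domain) :
    ∃ hx : (x : E) ∈ h.semigroup.generator.domain,
      h.semigroup.generator ⟨x, hx⟩ = operatorOfResolvent J 1 h.injective_one x := by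
  obtain ⟨v, hv, hA⟩ := exists_eq_apply_of_mem_domain (J := J) (hinj := h.injective h.one_mem) x.2
  obtain ⟨hx, hB⟩ := h.mem_generator_domain_resolvent v
  have hx' : (x : E) ∈ h.semigroup.generator.domain := by rw [← hv]; exact hx
  refine ⟨hx', ?_⟩
  have heq : (⟨(x : E), hx'⟩ : h.semigroup.generator.domain) = ⟨J 1 v, hx⟩ := Subtype.ext hv.symm
  rw [heq, hB, show operatorOfResolvent J 1 h.injective_one x = (1 : ℂ) • (x : E) - v
    from hA, one_smul, hv]

/-- In particular **`B(J(z)v) = zJ(z)v − v`** for every `z ∈ U`: `(z − B)J(z) = 1`.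
[cite: EngelNagel2000, Ch. II Thm. 3.5 proof] -/
theorem generator_resolvent (h : IsHilleYosidaData U J) {z : ℂ} (hz : z ∈ U) (v : E) :
    ∃ hx : J z v ∈ h.semigroup.generator.domain, h.semigroup.generator ⟨J z v, hx⟩ = z • J z v - v := by
  have hmem : J z v ∈ (operatorOfResolvent J 1 h.injective_one).domain :=
    h.pseudo.apply_mem_domain_of_mem h.one_mem hz v
  obtain ⟨hx, hB⟩ := h.mem_generator_domain ⟨J z v, hmem⟩
  refine ⟨hx, ?_⟩
  rw [hB]
  exact h.pseudo.apply_resolvent_of_mem h.one_mem hz v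

/-! ### §3 The Laplace transform of the semigroup is `J` -/

/-- **`∫₀^∞ e^{−λt} T(t)y dt = J(λ)y`** for every `λ ∈ U` with `Re λ > 0`: `x = J(λ)y ∈ D(B)` with
`λx − Bx = y`, and `R_B(λ)(λx − Bx) = x` (Engel–Nagel II.1.10 (iii), tree
`laplaceResolventFun_sub_generator`). [cite: EngelNagel2000, Ch. II Thm. 3.5] -/
theorem laplaceResolventFun_eq (h : IsHilleYosidaData U J) {l : ℂ} (hlU : l ∈ U) (hl : 0 < l.re) (y : E) :
    h.semigroup.laplaceResolventFun l y = J l y := by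
  obtain ⟨hx, hB⟩ := h.generator_resolvent hlU y
  have key := C0Semigroup.laplaceResolventFun_sub_generator h.semigroup h.norm_semigroup_app_le_exp hl ⟨J l y, hx⟩
  rw [hB] at key
  simpa using key

/-- The bundled form: **`T.laplaceResolvent λ = J λ`** on `U ∩ {Re λ > 0}`. [cite: EngelNagel2000, Ch. II Thm. 3.5] -/
theorem laplaceResolvent_eq (h : IsHilleYosidaData U J) {l : ℂ} (hlU : l ∈ U) (hl : 0 < l.re) :
    h.semigroup.laplaceResolvent h.norm_semigroup_app_le_exp l = J l := by
  ext y
  rw [C0Semigroup.laplaceResolvent_apply _ _ hl, h.laplaceResolventFun_eq hlU hl]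

/-- Real form: `∫₀^∞ e^{−λt} T(t)y dt = J(λ)y` for real `λ > 0`. [cite: EngelNagel2000, Ch. II Thm. 3.5] -/
theorem laplaceResolvent_eq_of_real (h : IsHilleYosidaData U J) {l : ℝ} (hl : 0 < l) :
    h.semigroup.laplaceResolvent h.norm_semigroup_app_le_exp l = J l :=
  h.laplaceResolvent_eq (h.mem l hl) (by simpa using hl)

/-! ### §4 The generator is `operatorOfResolvent J`; the generation theorem -/

/-- **The generator of the Hille–Yosida semigroup IS `A = operatorOfResolvent J`** (equality of
partially defined operators; in particular `D(B) = Ran J(1)`). [cite: EngelNagel2000, Ch. II Thm. 3.5] -/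
theorem generator_eq_operatorOfResolvent (h : IsHilleYosidaData U J) :
    h.semigroup.generator = operatorOfResolvent J 1 h.injective_one := by
  have h1 : (0 : ℝ) < (1 : ℂ).re := by simp
  rw [← C0Semigroup.operatorOfResolvent_laplaceResolvent_eq_generator h.semigroup
    h.norm_semigroup_app_le_exp h1]
  apply LinearPMap.eq_of_eq_graph
  ext p
  rw [mem_graph_operatorOfResolvent_iff, mem_graph_operatorOfResolvent_iff,
    h.laplaceResolvent_eq h.one_mem h1]

/-- `D(B) = Ran J(1)`. [cite: EngelNagel2000, Ch. II Thm. 3.5] -/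
theorem generator_domain (h : IsHilleYosidaData U J) :
    h.semigroup.generator.domain = LinearMap.range (J 1 : E →ₗ[ℂ] E) := by
  rw [h.generator_eq_operatorOfResolvent]; rfl

/-- **Hille–Yosida generation theorem (contraction case, pseudo-resolvent form).** Let `E` be a
complex Banach space and `J : ℂ → E →L[ℂ] E` a pseudo-resolvent on `U ⊇ (0, ∞)` with
`‖J(λ)‖ ≤ 1/λ` for real `λ > 0` and dense range. Then there is a contraction C₀-semigroup `T`
on `E` whose Laplace transform is `J` on `U ∩ {Re λ > 0}` — `∫₀^∞ e^{−λt}T(t)x dt = J(λ)x` —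
and whose generator is the closed operator `A = operatorOfResolvent J` (`J(λ) = (λ − A)⁻¹`,
Kato VIII-§1.1). Equivalently (Engel–Nagel II.3.5 (b) ⇒ (a)): a densely defined closed operator
`A` with `(0, ∞) ⊆ ρ(A)` and `‖λR(λ, A)‖ ≤ 1` generates a contraction semigroup.
[cite: EngelNagel2000, Ch. II Thm. 3.5] -/
theorem exists_c0Semigroup (h : IsHilleYosidaData U J) :
    ∃ T : C0Semigroup ℂ E, T.IsContraction ∧
      (∀ l ∈ U, 0 < l.re → ∀ x : E, T.laplaceResolventFun l x = J l x) ∧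
      T.generator = operatorOfResolvent J 1 h.injective_one :=
  ⟨h.semigroup, h.isContraction_semigroup, fun _ hlU hl x => h.laplaceResolventFun_eq hlU hl x,
    h.generator_eq_operatorOfResolvent⟩

end IsHilleYosidaData

end HilleYosida

end Literature.Analysis.UnboundedOperators
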